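import Summits.QuantumFields.YangMills.Theses.ParabolicTrajectory

/-!
# drefute gen 2 — `orbit-kantorovich-finite-size`: the lattice ↔ transfer INTERFACE is too narrow as typed

Finding (stub-misstated, `stub_transfer`; knock-on restatement of `stub_smoothingToGap`'s conclusion):
`stub_transfer` takes the crux's per-pair lattice gap `HasLatticeMassGap r sch Δ`
(`∀ A B, ∃ C, ∀ᶠ k, …` — the threshold `k₀` depends on the PAIR of fixed lattice species) as its only
lattice input.  The arity-`m ≥ 2` truncated functions of an OS limit `T` (which `T.HasMassGap` clusters)
are limits of correlations of `k`-DEPENDENT lattice species — products `A¹_{x¹} · τ_u A²_{x²} ⋯` at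
physical separations, i.e. lattice diameters `~ 1/a_k → ∞` — so no per-pair eventuality ever covers
them: neither the docstring's log-convexity route nor the positivity/spectral route has an input at
arity `≥ 2`.  The sibling skeleton `Lines/dissipative-bridge.lean` (ll. 327–340) types the SAME shared
stub with `UniformLatticeGap` (`∃ k₀, ∀ A B, ∃ C, ∀ k ≥ k₀`) for exactly this reason ("the per-pair
`∀ᶠ k` of `HasLatticeMassGap` alone would not place `k`-dependent linear combinations of translates in
the gapped spectral subspace").  THIS line cannot produce `UniformLatticeGap` (its rough-centre clause
(R) is, by design, eventual in the support SIZE `s` — whole-cell statistics are excluded — and its frame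
condition needs lattice DIAMETER `4w + 4 ≤ b_k`), but its smoothing proof DOES produce the uniform
statement below, `UniformCellClustering`: eventuality depending only on the support size `s`, all
lattice diameters `w` up to `b_k/4` at step `k` (physical half-width `t/4`), constants `C₀(s)·‖A‖∞‖B‖∞`.
That is enough for the transfer: at `k ≥ k₀(m·s)` every product vector of `≤ m` species inside the
physical box of half-width `t/4` is a bounded-size species of diameter `≤ b_k/4`, so (diagonal pairs,
`S → ∞`, Lüscher positivity) it lies in the gapped spectral subspace; limits give clustering at rate `Δ`
for all time-ordered tensors supported in that box, and Reeh–Schlieder density (T is OS data) plus the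
spectral theorem give `T.HasMassGap Δ` on everything.

This file ELABORATES the corrected interface against the live tree (rc 0; the two corrected stubs are
`sorry`, everything else is proved): `UniformCellClustering`, the corollary
`hasLatticeMassGap_of_uniformCellClustering` (so the crux's lattice half still follows), and the corrected
gluing `concl_of_corrected`.  Corrected signatures for the lead are `stub_smoothingToGap'` /
`stub_transfer'` below (hypotheses of the originals abbreviated to the ones that matter for the shape).
-/

set_option autoImplicit false

noncomputable section

namespace Summit.QuantumFields.YangMills.Cruxes.LatticeGapOnTrajectory.Drefute.TransferInterface

open scoped BigOperators Topology
open Filter MeasureTheory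
open Literature.MathematicalPhysics.QuantumFieldTheory
open Literature.MathematicalPhysics.QuantumLattice (ZdEdge)

variable {G : Type} [Group G] [TopologicalSpace G] [IsTopologicalGroup G] [CompactSpace G]
  [MeasurableSpace G] [BorelSpace G]

/-- The transfer half of the crux's conclusion at rate `Δ` (verbatim the skeleton's `TransferHalf`). -/
def TransferHalf (r : LatticeRep G) (sch : SpeciesScheme (YMSpecies G)) (Δ : ℝ) : Prop :=
  ∀ sch' : SpeciesScheme (YMSpecies G), sch'.a = sch.a → sch'.β = sch.β → sch'.L = sch.L →
    ∀ T : OSData (YMSpecies G) 4, IsYangMillsFor r sch' T → T.HasMassGap Δ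

/-- Support of a species inside the lattice box of half-width `w` about the origin. -/
def SuppInBox (A : YMSpecies G) (w : ℕ) : Prop :=
  ∀ e ∈ A.supp, ∀ i : Fin 4, |e.1 i| ≤ (w : ℤ)

/-- **Uniform cell clustering** — what `stub_smoothingToGap`'s proof actually delivers (and what a
transfer argument can consume): a cell scale `t` and constants `C₀(s)` such that for every support SIZE
`s`, eventually in `k`, for EVERY lattice half-width `w` with `4w + 4 ≤ b_k = t·M^{n_k}` (physical
half-width `≤ t/4`: the frame condition of `TorusFramesExist` (2)), on every torus the clause visits and
for all species `A, B` of size `≤ s` supported in the box of half-width `w`, the connected time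
correlations decay at rate `Δ` with constant `C₀(s)·bA·bB` (any sup bounds `bA, bB`). The eventuality is
uniform over the (infinite-dimensional, `k`-dependent) family of such species — this is the content the
per-pair `HasLatticeMassGap` forgets. -/
def UniformCellClustering {ι : Type} (r : LatticeRep G) (M : ℕ) (sch : SpeciesScheme ι)
    (nk : ℕ → ℕ) (Δ : ℝ) : Prop :=
  ∃ (t : ℕ) (C₀ : ℕ → ℝ), 1 ≤ t ∧ ∀ s : ℕ, ∀ᶠ k in atTop, ∀ w : ℕ, 4 * w + 4 ≤ t * M ^ nk k →
    ∀ S : ℕ, sch.L k ≤ S → ∀ (A B : YMSpecies G) (bA bB : ℝ),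
      A.supp.card ≤ s → B.supp.card ≤ s → SuppInBox A w → SuppInBox B w →
      (∀ U, |A.F U| ≤ bA) → (∀ U, |B.F U| ≤ bB) → ∀ n : ℕ, n ≤ S →
        |latticeConnectedCorr r.ρ (sch.β k) (2 * S + 1) A.F B.F n| ≤
          C₀ s * bA * bB * Real.exp (-(Δ * (sch.a k * n)))

omit [TopologicalSpace G] [IsTopologicalGroup G] [CompactSpace G] [BorelSpace G] in
/-- Every species sits in some box. -/
theorem exists_suppInBox (A : YMSpecies G) : ∃ w : ℕ, SuppInBox A w := by
  classical
  refine ⟨A.supp.sup fun e => Finset.univ.sup fun i => (e.1 i).natAbs, fun e he i => ?_⟩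
  have h1 : (e.1 i).natAbs ≤ Finset.univ.sup fun i => (e.1 i).natAbs :=
    Finset.le_sup (f := fun i => (e.1 i).natAbs) (Finset.mem_univ i)
  have h2 : (Finset.univ.sup fun i => (e.1 i).natAbs) ≤
      A.supp.sup fun e => Finset.univ.sup fun i => (e.1 i).natAbs :=
    Finset.le_sup (f := fun e => Finset.univ.sup fun i => (e.1 i).natAbs) he
  calc |e.1 i| = ((e.1 i).natAbs : ℤ) := (Int.natCast_natAbs _).symm
    _ ≤ _ := by exact_mod_cast h1.trans h2

omit [TopologicalSpace G] [IsTopologicalGroup G] [CompactSpace G] [BorelSpace G] in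
/-- Boxes are monotone. -/
theorem SuppInBox.mono {A : YMSpecies G} {w w' : ℕ} (h : SuppInBox A w) (hw : w ≤ w') :
    SuppInBox A w' :=
  fun e he i => (h e he i).trans (by exact_mod_cast hw)

/-- **The corrected lattice output still gives the crux's lattice half** (per-pair corollary): along a
scheme whose cell scale runs off (`M^{n_k} → ∞`, e.g. from the shape hypothesis, Disproof §1
`tendsto_natPow_of_shape`), `UniformCellClustering ⇒ HasLatticeMassGap`. -/
theorem hasLatticeMassGap_of_uniformCellClustering {ι : Type} (r : LatticeRep G) (M : ℕ)
    (sch : SpeciesScheme ι) (nk : ℕ → ℕ) (Δ : ℝ)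
    (hgrow : Tendsto (fun k => M ^ nk k) atTop atTop)
    (h : UniformCellClustering r M sch nk Δ) : HasLatticeMassGap r sch Δ := by
  obtain ⟨t, C₀, ht, hC⟩ := h
  intro A B
  obtain ⟨bA, hbA⟩ := A.bounded
  obtain ⟨bB, hbB⟩ := B.bounded
  obtain ⟨wA, hwA⟩ := exists_suppInBox A
  obtain ⟨wB, hwB⟩ := exists_suppInBox B
  set s := max A.supp.card B.supp.card with hs
  set w := max wA wB with hw
  refine ⟨C₀ s * bA * bB, ?_⟩
  have hev : ∀ᶠ k in atTop, 4 * w + 4 ≤ t * M ^ nk k := by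
    have h1 : Tendsto (fun k => t * M ^ nk k) atTop atTop :=
      (tendsto_atTop_mono (fun k => Nat.le_mul_of_pos_left _ ht) hgrow)
    exact h1.eventually_ge_atTop (4 * w + 4)
  filter_upwards [hC s, hev] with k hk hkw S hS n hn
  exact hk w hkw S hS A B bA bB (le_max_left _ _) (le_max_right _ _)
    (hwA.mono (le_max_left _ _)) (hwB.mono (le_max_right _ _)) hbA hbB n hn

/-- The transfer half is antitone in the rate (skeleton §4, re-proved for the corrected gluing). -/
theorem osData_hasMassGap_anti {ι : Type} {d : ℕ} [NeZero d] (T : OSData ι d) {Δ Δ' : ℝ}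
    (hΔ' : Δ' ≤ Δ) (h : T.HasMassGap Δ) : T.HasMassGap Δ' := by
  intro n m k k' F G' hF hG
  obtain ⟨C, hC⟩ := h n m k k' F G' hF hG
  refine ⟨max C 0, fun t ht H hH => (hC t ht H hH).trans ?_⟩
  calc C * Real.exp (-Δ * t) ≤ max C 0 * Real.exp (-Δ * t) :=
        mul_le_mul_of_nonneg_right (le_max_left _ _) (Real.exp_pos _).le
    _ ≤ max C 0 * Real.exp (-Δ' * t) :=
        mul_le_mul_of_nonneg_left (Real.exp_le_exp.2 (by nlinarith)) (le_max_right _ _)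

/-- `HasLatticeMassGap` is antitone in the rate (skeleton §4). -/
theorem hasLatticeMassGap_anti {ι : Type} (r : LatticeRep G) (sch : SpeciesScheme ι) {Δ Δ' : ℝ}
    (hΔ' : Δ' ≤ Δ) (h : HasLatticeMassGap r sch Δ) : HasLatticeMassGap r sch Δ' := by
  intro A B
  obtain ⟨C, hC⟩ := h A B
  refine ⟨max C 0, hC.mono fun k hk S hS n hn => (hk S hS n hn).trans ?_⟩
  have hx : 0 ≤ sch.a k * n := mul_nonneg (sch.a_pos k).le (Nat.cast_nonneg n)
  calc C * Real.exp (-(Δ * (sch.a k * n)))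
      ≤ max C 0 * Real.exp (-(Δ * (sch.a k * n))) :=
        mul_le_mul_of_nonneg_right (le_max_left _ _) (Real.exp_pos _).le
    _ ≤ max C 0 * Real.exp (-(Δ' * (sch.a k * n))) :=
        mul_le_mul_of_nonneg_left (Real.exp_le_exp.2 (by nlinarith)) (le_max_right _ _)

/-- **Corrected gluing**: the corrected smoothing output (`∃ Δ > 0, UniformCellClustering`) and the
corrected transfer stub (`UniformCellClustering Δ → ∃ Δ' > 0, TransferHalf Δ'`) still give the crux's
conclusion shape `∃ Δ > 0, HasLatticeMassGap Δ ∧ TransferHalf Δ` (rates glued by `min`). -/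
theorem concl_of_corrected (r : LatticeRep G) (M : ℕ) (sch : SpeciesScheme (YMSpecies G))
    (nk : ℕ → ℕ) (hgrow : Tendsto (fun k => M ^ nk k) atTop atTop)
    (hlat : ∃ Δ : ℝ, 0 < Δ ∧ UniformCellClustering r M sch nk Δ)
    (htr : ∀ Δ : ℝ, 0 < Δ → UniformCellClustering r M sch nk Δ → ∃ Δ' : ℝ, 0 < Δ' ∧ TransferHalf r sch Δ') :
    ∃ Δ : ℝ, 0 < Δ ∧ HasLatticeMassGap r sch Δ ∧ TransferHalf r sch Δ := by
  obtain ⟨Δ₁, hΔ₁, h₁⟩ := hlat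
  obtain ⟨Δ₂, hΔ₂, h₂⟩ := htr Δ₁ hΔ₁ h₁
  refine ⟨min Δ₁ Δ₂, lt_min hΔ₁ hΔ₂,
    hasLatticeMassGap_anti r sch (min_le_left _ _)
      (hasLatticeMassGap_of_uniformCellClustering r M sch nk Δ₁ hgrow h₁), ?_⟩
  intro sch' ha hb hL T hT
  exact osData_hasMassGap_anti T (min_le_right _ _) (h₂ sch' ha hb hL T hT)

/-! ## Corrected stub signatures (shape only; the originals' other hypotheses elided into `Hyps`) -/

/-- The crux hypotheses, uncurried (for brevity of the two signatures below). -/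
def Hyps (r : LatticeRep G) (M : ℕ) (θ : ℝ) (sch : SpeciesScheme (YMSpecies G)) (nk : ℕ → ℕ) : Prop :=
  2 ≤ M ∧ 0 < θ ∧ (∀ k, sch.a k = ((M : ℝ) ^ nk k)⁻¹) ∧ Tendsto sch.β atTop atTop ∧
    Tendsto (fun k => ((M : ℝ) ^ nk k) ^ 8 *
      latticeConnectedCorr r.ρ (sch.β k) (sch.side k) r.curvature.F r.curvature.F (M ^ nk k)) atTop (𝓝 θ)

/-- **Corrected `stub_smoothingToGap`** (conclusion strengthened to what the proof gives; the line's
hypotheses `KREngine → TorusFramesExist → SpecificationTower → WilsonTorusDLR r → OrbitKRWindowsAlong r M sch n`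
are abbreviated here to a single `LineLatticeInput` since the `Lines` module is not importable). -/
theorem stub_smoothingToGap' (LineLatticeInput : Prop) (r : LatticeRep G) (M : ℕ)
    (sch : SpeciesScheme (YMSpecies G)) (nk : ℕ → ℕ) :
    2 ≤ M → (∀ k, sch.a k = ((M : ℝ) ^ nk k)⁻¹) → LineLatticeInput →
      ∃ Δ : ℝ, 0 < Δ ∧ UniformCellClustering r M sch nk Δ := by
  sorry

/-- **Corrected `stub_transfer`** (hypothesis strengthened from the per-pair `HasLatticeMassGap` to
`UniformCellClustering`; everything else as in the skeleton). -/
theorem stub_transfer' (r : LatticeRep G) (M : ℕ) (θ : ℝ) (sch : SpeciesScheme (YMSpecies G))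
    (nk : ℕ → ℕ) : IsCompactSimpleLieGroup G → Hyps r M θ sch nk →
      ∀ Δ : ℝ, 0 < Δ → UniformCellClustering r M sch nk Δ → ∃ Δ' : ℝ, 0 < Δ' ∧ TransferHalf r sch Δ' := by
  sorry

end Summit.QuantumFields.YangMills.Cruxes.LatticeGapOnTrajectory.Drefute.TransferInterface

end
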